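import Summits.CriticalPhenomena.PercolationContinuityZ3.Theorems.PercNearOneGluingNoHeavyQuantCombCountLaw
import Summits.CriticalPhenomena.PercolationContinuityZ3.Theorems.PercNearOneGluingNoHeavyQuantCombLevels
import HarnessLib

/-!
# QUANT lane R8 — the spine tails of a comb: `e_k = (π_k − π_{k+1})·a_k + e_{k+1}`, unimodal `a_k`, and hair conditioning

builds on p205010 (kernel theorem, internal audit signed; external expert review pending)

Support file (`--supports stmt-CriticalPhenomena-4575`), QUANT lane lead (gen 9), rung R8 of `run/shared/lean/prim/quant/LADDER.md`;
memo `prim-quant-lead-g9/LEAD-NOTES-G9.md` N20 steps (0)–(2) — fifth file of the kernel proof of FAR (`Quant.FarTreeRow`) at EVERY layer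
on COMBS.  Coordinates of `…QuantCombLevels.lean`: gates `prodBernoulli q` on `Set ι`, ancestor finsets `P`, distinguished relay `a` with
spine `P a` (an unglued chain), levels `S k = {y ∈ P a | #(P y) ≤ k}`, `π_k = ∏_{S k} q`; a finite set `A` of OTHER relays whose spine parts are
down-closed and whose private parts `P z ∖ P a` are pairwise disjoint; layer `j`.  Events: `E_k = {#{z ∈ A | P z open} = j} ∩ {S k open}`
(`e_k` its probability), `D_k = {#{z ∈ A | level z ≤ k, private part open} = j}` (`a_k` its probability).  Theorems only; no sorries.

* `Quant.comb_count_eq_on_levelCut` — on `{S k open, S (k+1) not open}` the reach count of `A` is the private count of the relays of level `≤ k`;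
  `Quant.comb_count_eq_on_spineOpen` — on `{P a open}` it is the private count of all of `A`.
* `Quant.comb_tail_top` — `e_d = π_d · a_d` (`d = #(P a)`);  `Quant.comb_tail_step` — **`e_k = (π_k − π_{k+1})·a_k + e_{k+1}`** (`k < d`).
* `Quant.comb_levelLaw_noRise` — `k ↦ a_k` has no rise after a fall (`…QuantCombCountLaw.lean` on the nested level families).
* `Quant.comb_hair_conditioning` — **hair conditioning**: for one more relay `b ∉ A` whose private part is disjoint from the spine and from
  the other private parts, `P(#{z ∈ A ∪ {b} | P z open} ≤ j) = P(#{z ∈ A | P z open} ≤ j) − (∏_{P b ∖ P a} q)·e_{level b}`.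
[this work; independence of disjointly supported events: cite Grimmett1999 §2.2]
-/

noncomputable section

namespace Summit.CriticalPhenomena.PercolationContinuityZ3.Theorems

namespace Quant

open Finset MeasureTheory
open Literature.Probability.LatticeModels
open Literature.Probability.Percolation
open scoped Classical

variable {ι : Type*} [Fintype ι]

/-! ### Pointwise: what the reach count is on the spine cuts -/

omit [Fintype ι] in
/-- A relay is reached iff its spine level and its private part are open. [this work] -/
theorem comb_reached_iff (P : ι → Finset ι) (a : ι)
    (hsp : ∀ y ∈ P a, y ∈ P y ∧ P y ⊆ P a ∧ ∀ y' ∈ P a,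
      (y ∈ P y' ∨ y' ∈ P y) ∧ (y ∈ P y' → P y ⊆ P y') ∧ (y ∈ P y' → y' ∈ P y → y = y'))
    {z : ι} (hz : ∀ y ∈ P z, y ∈ P a → P y ⊆ P z) (ω : Set ι) :
    ((P z : Finset ι) : Set ι) ⊆ ω ↔
      (((P a).filter (fun y => (P y).card ≤ (P z ∩ P a).card) : Finset ι) : Set ι) ⊆ ω ∧ (((P z \ P a) : Finset ι) : Set ι) ⊆ ω := by
  conv_lhs => rw [comb_relay_prefix_eq P a hsp hz]
  rw [Finset.coe_union, Set.union_subset_iff]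

omit [Fintype ι] in
/-- **Count on a spine cut.**  On `{S k open} ∖ {S (k+1) open}` the relays of `A` that are reached are exactly those of level `≤ k`
whose private part is open. [this work] -/
theorem comb_count_eq_on_levelCut (P : ι → Finset ι) (a : ι) (A : Finset ι)
    (hsp : ∀ y ∈ P a, y ∈ P y ∧ P y ⊆ P a ∧ ∀ y' ∈ P a,
      (y ∈ P y' ∨ y' ∈ P y) ∧ (y ∈ P y' → P y ⊆ P y') ∧ (y ∈ P y' → y' ∈ P y → y = y'))
    (hA : ∀ z ∈ A, ∀ y ∈ P z, y ∈ P a → P y ⊆ P z) (k : ℕ) (ω : Set ι)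
    (hk : (((P a).filter (fun y => (P y).card ≤ k) : Finset ι) : Set ι) ⊆ ω)
    (hk1 : ¬ (((P a).filter (fun y => (P y).card ≤ k + 1) : Finset ι) : Set ι) ⊆ ω) :
    (A.filter fun z => ((P z : Finset ι) : Set ι) ⊆ ω).card =
      ((A.filter fun z => (P z ∩ P a).card ≤ k).filter fun z => (((P z \ P a) : Finset ι) : Set ι) ⊆ ω).card := by
  rw [Finset.filter_filter]
  congr 1
  refine Finset.filter_congr fun z hz => ?_
  rw [comb_reached_iff P a hsp (hA z hz)]
  constructor
  · rintro ⟨hS, hQ⟩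
    refine ⟨?_, hQ⟩
    by_contra hlt
    exact hk1 (subset_trans (Finset.coe_subset.2 (comb_level_mono P a (by omega))) hS)
  · rintro ⟨hle, hQ⟩
    exact ⟨subset_trans (Finset.coe_subset.2 (comb_level_mono P a hle)) hk, hQ⟩

omit [Fintype ι] in
/-- **Count when the whole spine is open**: the reach count of `A` is the private count of all of `A`. [this work] -/
theorem comb_count_eq_on_spineOpen (P : ι → Finset ι) (a : ι) (A : Finset ι)
    (hsp : ∀ y ∈ P a, y ∈ P y ∧ P y ⊆ P a ∧ ∀ y' ∈ P a,
      (y ∈ P y' ∨ y' ∈ P y) ∧ (y ∈ P y' → P y ⊆ P y') ∧ (y ∈ P y' → y' ∈ P y → y = y'))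
    (hA : ∀ z ∈ A, ∀ y ∈ P z, y ∈ P a → P y ⊆ P z) (ω : Set ι) (ha : ((P a : Finset ι) : Set ι) ⊆ ω) :
    (A.filter fun z => ((P z : Finset ι) : Set ι) ⊆ ω).card =
      ((A.filter fun z => (P z ∩ P a).card ≤ (P a).card).filter fun z => (((P z \ P a) : Finset ι) : Set ι) ⊆ ω).card := by
  rw [Finset.filter_filter]
  congr 1
  refine Finset.filter_congr fun z hz => ?_
  rw [comb_reached_iff P a hsp (hA z hz)]
  constructor
  · rintro ⟨-, hQ⟩; exact ⟨comb_relay_level_le P a z, hQ⟩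
  · rintro ⟨-, hQ⟩; exact ⟨subset_trans (Finset.coe_subset.2 (Finset.filter_subset _ _)) ha, hQ⟩

/-! ### The tails `e_k` -/

/-- `e_d = π_d · a_d`: when the whole spine is open the count is the private count (independent of the spine). [this work] -/
theorem comb_tail_top (q : ι → unitInterval) (P : ι → Finset ι) (a : ι) (A : Finset ι) (j : ℕ)
    (hsp : ∀ y ∈ P a, y ∈ P y ∧ P y ⊆ P a ∧ ∀ y' ∈ P a,
      (y ∈ P y' ∨ y' ∈ P y) ∧ (y ∈ P y' → P y ⊆ P y') ∧ (y ∈ P y' → y' ∈ P y → y = y'))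
    (hA : ∀ z ∈ A, ∀ y ∈ P z, y ∈ P a → P y ⊆ P z) :
    (prodBernoulli q).real {ω : Set ι | (A.filter fun z => ((P z : Finset ι) : Set ι) ⊆ ω).card = j ∧
        (((P a).filter (fun y => (P y).card ≤ (P a).card) : Finset ι) : Set ι) ⊆ ω} =
      (∏ y ∈ (P a).filter (fun y => (P y).card ≤ (P a).card), (q y : ℝ)) *
        (prodBernoulli q).real {ω : Set ι |
          ((A.filter fun z => (P z ∩ P a).card ≤ (P a).card).filter
            fun z => (((P z \ P a) : Finset ι) : Set ι) ⊆ ω).card = j} := by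
  have hmeas : ∀ T : Set (Set ι), MeasurableSet T := fun T => (Set.toFinite T).measurableSet
  rw [comb_level_top P a hsp]
  set O : Set (Set ι) := {ω | ((P a : Finset ι) : Set ι) ⊆ ω} with hO
  set D : Set (Set ι) := {ω | ((A.filter fun z => (P z ∩ P a).card ≤ (P a).card).filter
      fun z => (((P z \ P a) : Finset ι) : Set ι) ⊆ ω).card = j} with hD
  have hev : {ω : Set ι | (A.filter fun z => ((P z : Finset ι) : Set ι) ⊆ ω).card = j ∧ ((P a : Finset ι) : Set ι) ⊆ ω} = D ∩ O := by
    ext ω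
    simp only [Set.mem_setOf_eq, Set.mem_inter_iff, hD, hO]
    constructor
    · rintro ⟨hc, ha⟩; exact ⟨by rwa [← comb_count_eq_on_spineOpen P a A hsp hA ω ha], ha⟩
    · rintro ⟨hc, ha⟩; exact ⟨by rwa [comb_count_eq_on_spineOpen P a A hsp hA ω ha], ha⟩
  set F : Finset ι := A.biUnion fun z => P z \ P a with hF
  have hFS : Disjoint F (P a) := by
    rw [hF, Finset.disjoint_biUnion_left]; exact fun z _ => Finset.sdiff_disjoint
  have dD : DeterminedBy D (↑F : Set ι) :=
    determinedBy_card_filter_open _ (fun z => P z \ P a) F (fun z hz => Finset.subset_biUnion_of_mem (fun z => P z \ P a)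
      (Finset.mem_filter.1 hz).1) (fun c => c = j)
  rw [hev, prodBernoulli_real_inter_of_determinedBy_disjoint q hFS dD (determinedBy_subset_open (P a)) (hmeas _) (hmeas _),
    prodBernoulli_real_subset, mul_comm]

/-- **The tail recursion** `e_k = (π_k − π_{k+1})·a_k + e_{k+1}` for `k < d`. [this work] -/
theorem comb_tail_step (q : ι → unitInterval) (P : ι → Finset ι) (a : ι) (A : Finset ι) (j : ℕ)
    (hsp : ∀ y ∈ P a, y ∈ P y ∧ P y ⊆ P a ∧ ∀ y' ∈ P a,
      (y ∈ P y' ∨ y' ∈ P y) ∧ (y ∈ P y' → P y ⊆ P y') ∧ (y ∈ P y' → y' ∈ P y → y = y'))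
    (hA : ∀ z ∈ A, ∀ y ∈ P z, y ∈ P a → P y ⊆ P z) (k : ℕ) :
    (prodBernoulli q).real {ω : Set ι | (A.filter fun z => ((P z : Finset ι) : Set ι) ⊆ ω).card = j ∧
        (((P a).filter (fun y => (P y).card ≤ k) : Finset ι) : Set ι) ⊆ ω} =
      ((∏ y ∈ (P a).filter (fun y => (P y).card ≤ k), (q y : ℝ)) -
          ∏ y ∈ (P a).filter (fun y => (P y).card ≤ k + 1), (q y : ℝ)) *
        (prodBernoulli q).real {ω : Set ι |
          ((A.filter fun z => (P z ∩ P a).card ≤ k).filter fun z => (((P z \ P a) : Finset ι) : Set ι) ⊆ ω).card = j} +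
      (prodBernoulli q).real {ω : Set ι | (A.filter fun z => ((P z : Finset ι) : Set ι) ⊆ ω).card = j ∧
        (((P a).filter (fun y => (P y).card ≤ k + 1) : Finset ι) : Set ι) ⊆ ω} := by
  set μ := prodBernoulli q with hμ
  have hmeas : ∀ T : Set (Set ι), MeasurableSet T := fun T => (Set.toFinite T).measurableSet
  set Sk : Finset ι := (P a).filter (fun y => (P y).card ≤ k) with hSk
  set Sk1 : Finset ι := (P a).filter (fun y => (P y).card ≤ k + 1) with hSk1
  set Ok : Set (Set ι) := {ω | ((Sk : Finset ι) : Set ι) ⊆ ω} with hOk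
  set Ok1 : Set (Set ι) := {ω | ((Sk1 : Finset ι) : Set ι) ⊆ ω} with hOk1
  set C : Set (Set ι) := {ω | (A.filter fun z => ((P z : Finset ι) : Set ι) ⊆ ω).card = j} with hC
  set D : Set (Set ι) := {ω | ((A.filter fun z => (P z ∩ P a).card ≤ k).filter
      fun z => (((P z \ P a) : Finset ι) : Set ι) ⊆ ω).card = j} with hD
  have hsub : Sk ⊆ Sk1 := comb_level_mono P a (Nat.le_succ k)
  have hO : Ok1 ⊆ Ok := fun ω hω => subset_trans (Finset.coe_subset.2 hsub) hω
  -- the event identities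
  have hEk : {ω : Set ι | (A.filter fun z => ((P z : Finset ι) : Set ι) ⊆ ω).card = j ∧ ((Sk : Finset ι) : Set ι) ⊆ ω} = C ∩ Ok := by
    ext ω; simp [hC, hOk]
  have hEk1 : {ω : Set ι | (A.filter fun z => ((P z : Finset ι) : Set ι) ⊆ ω).card = j ∧ ((Sk1 : Finset ι) : Set ι) ⊆ ω} =
      C ∩ Ok1 := by
    ext ω; simp [hC, hOk1]
  have hsplit : C ∩ Ok = (C ∩ Ok1) ∪ (D ∩ (Ok \ Ok1)) := by
    ext ω
    simp only [Set.mem_inter_iff, Set.mem_union, Set.mem_sdiff, hC, hD, hOk, hOk1, Set.mem_setOf_eq]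
    constructor
    · rintro ⟨hc, hk⟩
      by_cases h1 : ((Sk1 : Finset ι) : Set ι) ⊆ ω
      · exact Or.inl ⟨hc, h1⟩
      · exact Or.inr ⟨by rwa [← comb_count_eq_on_levelCut P a A hsp hA k ω hk h1], hk, h1⟩
    · rintro (⟨hc, h1⟩ | ⟨hd, hk, h1⟩)
      · exact ⟨hc, hO h1⟩
      · exact ⟨by rwa [comb_count_eq_on_levelCut P a A hsp hA k ω hk h1], hk⟩
  have hdisj : Disjoint (C ∩ Ok1) (D ∩ (Ok \ Ok1)) :=
    Set.disjoint_left.2 fun ω h h' => h'.2.2 h.2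
  -- independence of the private count from the spine
  set F : Finset ι := A.biUnion fun z => P z \ P a with hF
  have hFS : Disjoint F (P a) := by
    rw [hF, Finset.disjoint_biUnion_left]; exact fun z _ => Finset.sdiff_disjoint
  have hFk : Disjoint F Sk := hFS.mono_right (Finset.filter_subset _ _)
  have hFk1 : Disjoint F Sk1 := hFS.mono_right (Finset.filter_subset _ _)
  have dD : DeterminedBy D (↑F : Set ι) :=
    determinedBy_card_filter_open _ (fun z => P z \ P a) F (fun z hz => Finset.subset_biUnion_of_mem (fun z => P z \ P a)
      (Finset.mem_filter.1 hz).1) (fun c => c = j)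
  have p1 : μ.real (D ∩ Ok) = μ.real D * μ.real Ok :=
    prodBernoulli_real_inter_of_determinedBy_disjoint q hFk dD (determinedBy_subset_open Sk) (hmeas _) (hmeas _)
  have p2 : μ.real (D ∩ Ok1) = μ.real D * μ.real Ok1 :=
    prodBernoulli_real_inter_of_determinedBy_disjoint q hFk1 dD (determinedBy_subset_open Sk1) (hmeas _) (hmeas _)
  have p3 : μ.real (D ∩ (Ok \ Ok1)) = μ.real (D ∩ Ok) - μ.real (D ∩ Ok1) := by
    have h := measureReal_inter_add_sdiff (μ := μ) (s := D ∩ Ok) (t := Ok1) (hmeas _)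
    have e1 : D ∩ Ok ∩ Ok1 = D ∩ Ok1 := by
      rw [Set.inter_assoc, Set.inter_eq_self_of_subset_right hO]
    have e2 : (D ∩ Ok) \ Ok1 = D ∩ (Ok \ Ok1) := by rw [Set.inter_sdiff_assoc]
    rw [e1, e2] at h; linarith
  have hπk : μ.real Ok = ∏ y ∈ Sk, (q y : ℝ) := prodBernoulli_real_subset q Sk
  have hπk1 : μ.real Ok1 = ∏ y ∈ Sk1, (q y : ℝ) := prodBernoulli_real_subset q Sk1
  rw [hEk, hEk1, hsplit, measureReal_union hdisj (hmeas _), p3, p1, p2, hπk, hπk1]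
  ring

/-! ### No rise after a fall for the level laws -/

/-- `k ↦ a_k = P(D_k)` has no rise after a fall: `i < k ≤ l`, `a_k < a_i ⟹ a_l ≤ a_k`. [this work] -/
theorem comb_levelLaw_noRise (q : ι → unitInterval) (P : ι → Finset ι) (a : ι) (A : Finset ι) (j : ℕ)
    (hdisj : ∀ z ∈ A, ∀ z' ∈ A, z ≠ z' → Disjoint (P z \ P a) (P z' \ P a)) {i k l : ℕ} (hik : i < k) (hkl : k ≤ l)
    (hfall : (prodBernoulli q).real {ω : Set ι |
        ((A.filter fun z => (P z ∩ P a).card ≤ k).filter fun z => (((P z \ P a) : Finset ι) : Set ι) ⊆ ω).card = j} <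
      (prodBernoulli q).real {ω : Set ι |
        ((A.filter fun z => (P z ∩ P a).card ≤ i).filter fun z => (((P z \ P a) : Finset ι) : Set ι) ⊆ ω).card = j}) :
    (prodBernoulli q).real {ω : Set ι |
        ((A.filter fun z => (P z ∩ P a).card ≤ l).filter fun z => (((P z \ P a) : Finset ι) : Set ι) ⊆ ω).card = j} ≤
      (prodBernoulli q).real {ω : Set ι |
        ((A.filter fun z => (P z ∩ P a).card ≤ k).filter fun z => (((P z \ P a) : Finset ι) : Set ι) ⊆ ω).card = j} := by
  refine indepEvents_law_noRise q (fun z => P z \ P a) (A.filter fun z => (P z ∩ P a).card ≤ i)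
    (A.filter fun z => (P z ∩ P a).card ≤ k) (A.filter fun z => (P z ∩ P a).card ≤ l) ?_ ?_ ?_ j hfall
  · intro z hz; rw [Finset.mem_filter] at hz ⊢; exact ⟨hz.1, by omega⟩
  · intro z hz; rw [Finset.mem_filter] at hz ⊢; exact ⟨hz.1, by omega⟩
  · intro z hz z' hz' hne
    exact hdisj z (Finset.mem_filter.1 hz).1 z' (Finset.mem_filter.1 hz').1 hne

/-! ### Hair conditioning -/

/-- **Hair conditioning.**  Add one relay `b ∉ A` whose spine part is down-closed and whose private part `P b ∖ P a` misses every
private part of `A`.  Then `P(#{z ∈ A ∪ {b} | P z open} ≤ j) = P(#{z ∈ A | P z open} ≤ j) − (∏_{P b ∖ P a} q) · e_{level b}`. [this work] -/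
theorem comb_hair_conditioning (q : ι → unitInterval) (P : ι → Finset ι) (a : ι) (A : Finset ι) (j : ℕ) {b : ι} (hb : b ∉ A)
    (hsp : ∀ y ∈ P a, y ∈ P y ∧ P y ⊆ P a ∧ ∀ y' ∈ P a,
      (y ∈ P y' ∨ y' ∈ P y) ∧ (y ∈ P y' → P y ⊆ P y') ∧ (y ∈ P y' → y' ∈ P y → y = y'))
    (hA : ∀ z ∈ A, ∀ y ∈ P z, y ∈ P a → P y ⊆ P z) (hbdown : ∀ y ∈ P b, y ∈ P a → P y ⊆ P b)
    (hbdisj : ∀ z ∈ A, Disjoint (P z \ P a) (P b \ P a)) :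
    (prodBernoulli q).real {ω : Set ι | ((insert b A).filter fun z => ((P z : Finset ι) : Set ι) ⊆ ω).card ≤ j} =
      (prodBernoulli q).real {ω : Set ι | (A.filter fun z => ((P z : Finset ι) : Set ι) ⊆ ω).card ≤ j} -
        (∏ y ∈ P b \ P a, (q y : ℝ)) *
          (prodBernoulli q).real {ω : Set ι | (A.filter fun z => ((P z : Finset ι) : Set ι) ⊆ ω).card = j ∧
            (((P a).filter (fun y => (P y).card ≤ (P b ∩ P a).card) : Finset ι) : Set ι) ⊆ ω} := by
  set μ := prodBernoulli q with hμ
  have hmeas : ∀ T : Set (Set ι), MeasurableSet T := fun T => (Set.toFinite T).measurableSet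
  set Sb : Finset ι := (P a).filter (fun y => (P y).card ≤ (P b ∩ P a).card) with hSb
  set Qb : Finset ι := P b \ P a with hQb
  set L : Set (Set ι) := {ω | (A.filter fun z => ((P z : Finset ι) : Set ι) ⊆ ω).card ≤ j} with hL
  set E : Set (Set ι) := {ω | (A.filter fun z => ((P z : Finset ι) : Set ι) ⊆ ω).card = j ∧ ((Sb : Finset ι) : Set ι) ⊆ ω} with hE
  set OQ : Set (Set ι) := {ω | ((Qb : Finset ι) : Set ι) ⊆ ω} with hOQ
  have hPb : ∀ ω : Set ι, ((P b : Finset ι) : Set ι) ⊆ ω ↔ ((Sb : Finset ι) : Set ι) ⊆ ω ∧ ((Qb : Finset ι) : Set ι) ⊆ ω :=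
    fun ω => comb_reached_iff P a hsp hbdown ω
  have hev : {ω : Set ι | ((insert b A).filter fun z => ((P z : Finset ι) : Set ι) ⊆ ω).card ≤ j} = L \ (E ∩ OQ) := by
    ext ω
    simp only [Set.mem_setOf_eq, Set.mem_sdiff, Set.mem_inter_iff, hL, hE, hOQ]
    rw [indepEvents_card_filter_insert P A hb ω]
    by_cases h : ((P b : Finset ι) : Set ι) ⊆ ω
    · obtain ⟨h1, h2⟩ := (hPb ω).1 h
      simp only [h, ↓reduceIte, h1, h2, and_true]
      omega
    · simp only [h, ↓reduceIte, add_zero]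
      have : ¬ (((Sb : Finset ι) : Set ι) ⊆ ω ∧ ((Qb : Finset ι) : Set ι) ⊆ ω) := fun h' => h ((hPb ω).2 h')
      tauto
  have hsub : E ∩ OQ ⊆ L := fun ω hω => by
    simp only [hL, hE, Set.mem_setOf_eq, Set.mem_inter_iff] at hω ⊢; omega
  -- independence: `E` lives on the prefixes of `A` and on the spine, `OQ` on the private part of `b`
  set G : Finset ι := (A.biUnion P) ∪ P a with hG
  have hGQ : Disjoint G Qb := by
    rw [hG, Finset.disjoint_union_left, Finset.disjoint_biUnion_left]
    refine ⟨fun z hz => ?_, ?_⟩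
    · rw [comb_relay_prefix_eq P a hsp (hA z hz), Finset.disjoint_union_left]
      exact ⟨(Finset.disjoint_sdiff.mono_left (Finset.filter_subset _ _)).symm.symm, hbdisj z hz⟩
    · exact Finset.disjoint_sdiff
  have dE : DeterminedBy E (↑G : Set ι) := by
    have d1 : DeterminedBy {ω : Set ι | (A.filter fun z => ((P z : Finset ι) : Set ι) ⊆ ω).card = j} (↑G : Set ι) :=
      (determinedBy_card_filter_open A P (A.biUnion P) (fun z hz => Finset.subset_biUnion_of_mem P hz) (fun c => c = j)).mono
        (by rw [hG]; exact Finset.coe_subset.2 Finset.subset_union_left)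
    have d2 : DeterminedBy {ω : Set ι | ((Sb : Finset ι) : Set ι) ⊆ ω} (↑G : Set ι) :=
      (determinedBy_subset_open Sb).mono (Finset.coe_subset.2 ((Finset.filter_subset _ _).trans (by rw [hG]; exact Finset.subset_union_right)))
    have : E = {ω : Set ι | (A.filter fun z => ((P z : Finset ι) : Set ι) ⊆ ω).card = j} ∩ {ω | ((Sb : Finset ι) : Set ι) ⊆ ω} := by
      ext ω; simp [hE]
    rw [this]; exact d1.inter d2
  have p1 : μ.real (E ∩ OQ) = μ.real E * μ.real OQ :=
    prodBernoulli_real_inter_of_determinedBy_disjoint q hGQ dE (determinedBy_subset_open Qb) (hmeas _) (hmeas _)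
  rw [hev, measureReal_sdiff hsub (hmeas _), p1, prodBernoulli_real_subset q Qb]
  ring

end Quant

end Summit.CriticalPhenomena.PercolationContinuityZ3.Theorems

end
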